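import Literature.AlgebraicGeometry.Frobenioids.BiratUnitsEquivalence
import Literature.AlgebraicGeometry.Frobenioids.ModelFrobenioidRatIsoFrac
import Literature.AnabelianGeometry.EtaleTheta.BiKummerThm44SubModelSupports

/-!
# [EtTh] Theorem 4.4 (ii): the `1`-compatible `Ψ^birat` on `O^×(A^birat)` (sub-DAG row T44-L10) CONSTRUCTED and its
# compatibilities PROVED at the canonical model instance — proof-only companion (plus the construction)

S. Mochizuki, *The étale theta function …*, Publ. RIMS **45** (2009) [MochizukiEtTh2009], §4, Thm 4.4 (ii), p.94:
"`Ψ` induces a 1-compatible equivalence of categories `Ψ^birat : C₁^birat ⥲ C₂^birat`. Moreover, `Ψ` preserves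
fraction-pairs …", proof p.95 ll.7–8: "The existence of `Ψ^birat` follows from [FrdI], Corollary 4.10."  Row
T44-L10 of `plan/L2/SUBDAG-EtTh-Thm44.md` (`Thm44Hyp.BiratCompatible h ψ`, `BiKummerThm44Sub.lean`) records the
three uses the printed proof makes of `Ψ^birat` on `O^×(A^birat)`: compatibility with (a) restriction along
pre-steps "`f ↦ f|_B`", (b) the fractions `s'·(s'')⁻¹`, (c) the `Aut_C(A)`-actions — as a NAMED INPUT over the free
birational fields of `BiKummerSetting` and a free datum `ψ`.  At the model instance `BiKummerSetting.mkOfModel`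
(abc-iut-L2-t9: `O^×(A^birat) := B(A_D)^×`, [FrdI] Thm 5.2 (ii)) the datum `ψ` is CONSTRUCTED and (a)(b)(c) are
THEOREMS:
* `Thm44Hyp.biratUnitsEquiv` — `Ψ` on abc-iut-L1-t2's intrinsic `O^×(A^birat) = PreFrobenioid.BiratUnits` (fractions
  of co-angular pre-steps, [FrdI] Prop 4.4 (iv)), an isomorphism by `BiratUnits.equivOfEquiv` ([FrdI] Cor 4.10 on
  units, `Frobenioids/BiratUnitsEquivalence.lean`): `Ψ`, `Ψ⁻¹` preserve co-angular pre-steps (T44-L03 + [FrdI]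
  Prop 1.4 (i), `C_i` isotropic by Thm 3.7 (i)) and base-equivalent pairs (`Ψ^bs`);
* `Thm44Hyp.psiVal` / `Thm44Hyp.psiModel` — transported through abc-iut-L1-t2's [FrdI] Thm 5.2 (ii) isomorphism
  `ModelFrobenioid.ratIso : B(A_D) ≅ O^×(A^birat)` on both sides: `ψ_A : B₁(A_D)^× ≅ B₂(Ψ(A)_D)^×`;
* `psiVal_frac` ((b): `ψ_A(u_{s'}·u_{s''}⁻¹) = u_{Ψ s'}·u_{Ψ s''}⁻¹`, via `ModelFrobenioid.ratIso_frac` and a completing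
  square `κ ≫ s' = κ' ≫ s''`, [FrdI] Def 1.3 (iii)(d)), `psiVal_map_inv_baseMap` ((a)/(c): `ψ` commutes with
  transport along `Base(s)⁻¹`, via `ratIso_map_inv_baseMap` and `equivOfEquiv_push`) — ANY pair of settings;
* `Thm44Hyp.biratCompatible_mkOfModel` — **T44-L10 `BiratCompatible h ψ` for `S_i := mkOfModel`**, inputs "`C_i`
  Frobenioid" + T44-L03 only; `thm44_ii_mkOfModelCanonical` — **Thm 4.4 (ii) fraction-pair clause `Thm44_ii h ψ` for
  the canonical model instances ⇐ {`Remark372 D₀ / D₀'` (Rmk 3.7.2), `hBmon₁ / hBmon₂`} ONLY** (with p420137's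
  `thm44_ii_mkOfModelCanonical_of_frac`: T44-L03, T44-L10 (b), T44-L12 all discharged).
HONEST FRAMING: refereed pre-IUT material ([EtTh] §4 over [FrdI] §§4–5); no new `Prop` fact; the only definitions
are the transported isomorphisms `biratUnitsEquiv`/`psiVal`/`psiModel`; nothing here bears on [IUTchIII] Cor. 3.12;
typed ≠ proved — here PROVED.
-/

noncomputable section

namespace Literature.AnabelianGeometry.EtaleTheta

open CategoryTheory Opposite Literature.AlgebraicGeometry.Frobenioids

namespace BiKummerSetting

universe u₀ v₀ u v w

variable {K : Type u₀} [Field K] {K' : Type u₀} [Field K'] {D₀ : Type u₀} [Category.{v₀} D₀]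
  {V : FrdIMonoidStub.{w}}
  {X₁ : SemiGraphs.TemperedArithmeticGroup.{u₀} K} {X₂ : SemiGraphs.TemperedArithmeticGroup.{u₀} K'}
  {D₀' : Type u₀} [Category.{v₀} D₀']
  {T₁ : RealifiedDivisorMonoids (D₀ := D₀) V} {T₂ : RealifiedDivisorMonoids (D₀ := D₀') V}
  {D₁ D₂ : Type u} [Category.{v} D₁] [Category.{v} D₂] {VD₁ : FrdICatStub.{u, v, w} D₁}
  {VD₂ : FrdICatStub.{u, v, w} D₂}

section AnySetting

variable {S₁ : BiKummerSetting X₁ T₁ D₁ VD₁} {S₂ : BiKummerSetting X₂ T₂ D₂ VD₂}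

/-! ### `Ψ`, `Ψ⁻¹` preserve co-angular pre-steps and base-equivalent pairs -/

/-- `Ψ` preserves co-angular pre-steps: pre-steps by T44-L03 (`isPreStep_map`), co-angularity being automatic in a
Frobenioid of isotropic type ([FrdI] Prop 1.4 (i); Thm 3.7 (i)). [cite: MochizukiEtTh2009, Thm 4.4 p.95] -/
theorem Thm44Hyp.isCoAngularPreStep_map (h : Thm44Hyp S₁ S₂) (h3 : h.PreservesFrobeniusStructure) {A B : S₁.C}
    {f : A ⟶ B} (hf : PreFrobenioid.IsCoAngularPreStep S₁.F f) :
    PreFrobenioid.IsCoAngularPreStep S₂.F (h.Ψ.functor.map f) :=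
  ⟨PreFrobenioid.isCoAngular_of_isIsotropic_codomains S₂.F _ fun Z _ =>
      TemperedFrobenioid.thm37_i_isotropic_holds S₂.tf Z,
    h.isPreStep_map h3 hf.2⟩

/-- `Ψ⁻¹` preserves co-angular pre-steps (`isPreStep_inverse_map`; [FrdI] Prop 1.4 (i)).
[cite: MochizukiEtTh2009, Thm 4.4 p.95] -/
theorem Thm44Hyp.isCoAngularPreStep_inverse_map (h : Thm44Hyp S₁ S₂) (h3 : h.PreservesFrobeniusStructure)
    {X Y : S₂.C} {f : X ⟶ Y} (hf : PreFrobenioid.IsCoAngularPreStep S₂.F f) :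
    PreFrobenioid.IsCoAngularPreStep S₁.F (h.Ψ.inverse.map f) :=
  ⟨PreFrobenioid.isCoAngular_of_isIsotropic_codomains S₁.F _ fun Z _ =>
      TemperedFrobenioid.thm37_i_isotropic_holds S₁.tf Z,
    h.isPreStep_inverse_map h3 hf.2⟩

/-- A pre-step of `C₁` is a co-angular pre-step ([FrdI] Prop 1.4 (i); Thm 3.7 (i) "isotropic").
[cite: MochizukiEtTh2009, Thm 3.7 p.79] -/
theorem isCoAngularPreStep_of_isPreStep (S : BiKummerSetting X₁ T₁ D₁ VD₁) {A B : S.C} {f : A ⟶ B}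
    (hf : S.IsPreStep f) : PreFrobenioid.IsCoAngularPreStep S.F f :=
  ⟨PreFrobenioid.isCoAngular_of_isIsotropic_codomains S.F _ fun Z _ =>
      TemperedFrobenioid.thm37_i_isotropic_holds S.tf Z, hf⟩

/-- `Ψ` REFLECTS base-equivalence (`Ψ^bs` is faithful). [cite: MochizukiEtTh2009, Thm 4.4 p.95] -/
theorem Thm44Hyp.baseEquivalent_of_map (h : Thm44Hyp S₁ S₂) {A B : S₁.C} {a b : A ⟶ B}
    (hab : PreFrobenioid.BaseEquivalent S₂.F (h.Ψ.functor.map a) (h.Ψ.functor.map b)) :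
    PreFrobenioid.BaseEquivalent S₁.F a b := by
  have e : S₂.base.map (h.Ψ.functor.map a) = S₂.base.map (h.Ψ.functor.map b) := hab
  rw [h.base_map_Ψ_cmp, h.base_map_Ψ_cmp] at e
  have e' : h.Ψbs.functor.map (S₁.base.map a) = h.Ψbs.functor.map (S₁.base.map b) :=
    (cancel_mono (h.cmp B).hom).1 ((cancel_epi (h.cmp A).inv).1 e)
  exact h.Ψbs.functor.map_injective e'

/-- `Ψ⁻¹` preserves base-equivalent pairs. [cite: MochizukiEtTh2009, Thm 4.4 p.95] -/
theorem Thm44Hyp.baseEquivalent_inverse_map (h : Thm44Hyp S₁ S₂) {X Y : S₂.C} {f g : X ⟶ Y}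
    (hfg : PreFrobenioid.BaseEquivalent S₂.F f g) :
    PreFrobenioid.BaseEquivalent S₁.F (h.Ψ.inverse.map f) (h.Ψ.inverse.map g) := by
  apply h.baseEquivalent_of_map
  -- `Base₂(Ψ Ψ⁻¹ m) = Base₂(c_X) ≫ Base₂(m) ≫ Base₂(c_Y⁻¹)` along the counit `c : Ψ Ψ⁻¹ ≅ 1`
  have key : ∀ m : X ⟶ Y, S₂.base.map (h.Ψ.functor.map (h.Ψ.inverse.map m)) =
      S₂.base.map (h.Ψ.counit.app X) ≫ S₂.base.map m ≫ S₂.base.map (h.Ψ.counitInv.app Y) := fun m =>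
    (congrArg (fun t => S₂.base.map t) (h.Ψ.fun_inv_map X Y m)).trans
      ((S₂.base.map_comp (h.Ψ.counit.app X) (m ≫ h.Ψ.counitInv.app Y)).trans
        (congrArg (fun t => S₂.base.map (h.Ψ.counit.app X) ≫ t) (S₂.base.map_comp m (h.Ψ.counitInv.app Y))))
  show S₂.base.map (h.Ψ.functor.map (h.Ψ.inverse.map f)) = S₂.base.map (h.Ψ.functor.map (h.Ψ.inverse.map g))
  rw [key f, key g]
  exact congrArg (fun t : S₂.base.obj X ⟶ S₂.base.obj Y =>
    S₂.base.map (h.Ψ.counit.app X) ≫ t ≫ S₂.base.map (h.Ψ.counitInv.app Y)) hfg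

/-! ### `Ψ^birat` on `O^×(A^birat)`: intrinsically, and through [FrdI] Thm 5.2 (ii) on `B(A_D)` -/

/-- **`Ψ^birat : O^×(A^birat) ≅ O^×(Ψ(A)^birat)`** on the intrinsic rational function monoids ([FrdI] Prop 4.4 (iv)
fractions; `BiratUnits.equivOfEquiv`, Cor 4.10 on units), from "`C_i` Frobenioid" and T44-L03.
[cite: MochizukiEtTh2009, Thm 4.4 p.94] -/
def Thm44Hyp.biratUnitsEquiv (h : Thm44Hyp S₁ S₂) (hF₁ : PreFrobenioid.IsFrobenioid S₁.F)
    (hF₂ : PreFrobenioid.IsFrobenioid S₂.F) (h3 : h.PreservesFrobeniusStructure) (A : S₁.C) :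
    PreFrobenioid.BiratUnits S₁.F hF₁ A ≃* PreFrobenioid.BiratUnits S₂.F hF₂ (h.Ψ.functor.obj A) :=
  PreFrobenioid.BiratUnits.equivOfEquiv h.Ψ (fun _ _ _ hf => h.isCoAngularPreStep_map h3 hf)
    (fun _ _ _ _ hb => h.baseEquivalent_map hb) hF₁ hF₂ (fun _ _ _ hf => h.isCoAngularPreStep_inverse_map h3 hf)
    (fun _ _ _ _ hfg => h.baseEquivalent_inverse_map hfg) A

/-- **`Ψ^birat` on `B(A_D)`** ([FrdI] Thm 5.2 (ii): `B(−) ≅ O^×((−)^birat)` on both sides, abc-iut-L1-t2's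
`ModelFrobenioid.ratIso`): `B₁(A_D) ≅ O^×(A^birat) ≅ O^×(Ψ(A)^birat) ≅ B₂(Ψ(A)_D)`. [cite: MochizukiEtTh2009, Thm 4.4 p.94] -/
def Thm44Hyp.psiVal (h : Thm44Hyp S₁ S₂) (hF₁ : PreFrobenioid.IsFrobenioid S₁.F)
    (hF₂ : PreFrobenioid.IsFrobenioid S₂.F) (h3 : h.PreservesFrobeniusStructure) (A : S₁.C) :
    S₁.tf.ratFnFunctor.obj (op A.base) ≃* S₂.tf.ratFnFunctor.obj (op (h.Ψ.functor.obj A).base) :=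
  (ModelFrobenioid.ratIso S₁.tf.ratFnFunctor_isGroupLike_holds hF₁.isPreFrobenioid.isDivisorial hF₁ A).trans
    ((h.biratUnitsEquiv hF₁ hF₂ h3 A).trans
      (ModelFrobenioid.ratIso S₂.tf.ratFnFunctor_isGroupLike_holds hF₂.isPreFrobenioid.isDivisorial hF₂
        (h.Ψ.functor.obj A)).symm)

/-- **The datum `ψ_A : O^×(A^birat) ≅ O^×(Ψ(A)^birat)` of Thm 4.4 (ii)–(iv) for the model reading
`O^×(A^birat) := B(A_D)^×`** (`TemperedFrobenioid.biratUnitsModel`): `psiVal` on units.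
[cite: MochizukiEtTh2009, Thm 4.4 p.94] -/
def Thm44Hyp.psiModel (h : Thm44Hyp S₁ S₂) (hF₁ : PreFrobenioid.IsFrobenioid S₁.F)
    (hF₂ : PreFrobenioid.IsFrobenioid S₂.F) (h3 : h.PreservesFrobeniusStructure) (A : S₁.C) :
    S₁.tf.biratUnitsModel A ≃* S₂.tf.biratUnitsModel (h.Ψ.functor.obj A) :=
  Units.mapEquiv (h.psiVal hF₁ hF₂ h3 A)

/-- `psiModel` on values. [cite: MochizukiEtTh2009, Thm 4.4 p.94] -/
theorem Thm44Hyp.coe_psiModel (h : Thm44Hyp S₁ S₂) (hF₁ : PreFrobenioid.IsFrobenioid S₁.F)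
    (hF₂ : PreFrobenioid.IsFrobenioid S₂.F) (h3 : h.PreservesFrobeniusStructure) (A : S₁.C)
    (f : S₁.tf.biratUnitsModel A) :
    ((h.psiModel hF₁ hF₂ h3 A f : S₂.tf.biratUnitsModel (h.Ψ.functor.obj A)) :
        S₂.tf.ratFnFunctor.obj (op (h.Ψ.functor.obj A).base)) =
      h.psiVal hF₁ hF₂ h3 A (f : S₁.tf.ratFnFunctor.obj (op A.base)) :=
  Units.coe_mapEquiv _ _

/-! ### (b) fractions: `ψ_A(s'·(s'')⁻¹) = Ψ(s')·Ψ(s'')⁻¹` -/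

/-- **(b)** `ψ_A` carries the model fraction `u_{s'}·u_{s''}⁻¹` of a base-equivalent pair of pre-steps `s', s''`
to `u_{Ψ s'}·u_{Ψ s''}⁻¹`: both correspond, under [FrdI] Thm 5.2 (ii), to the class of a completing square
`κ ≫ s' = κ' ≫ s''` ([FrdI] Def 1.3 (iii)(d)) resp. of its image under `Ψ` (`ModelFrobenioid.ratIso_frac`), and
`Ψ^birat[(κ, κ')] = [(Ψ κ, Ψ κ')]`. [cite: MochizukiEtTh2009, Thm 4.4 p.95] -/
theorem Thm44Hyp.psiVal_frac (h : Thm44Hyp S₁ S₂) (hF₁ : PreFrobenioid.IsFrobenioid S₁.F)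
    (hF₂ : PreFrobenioid.IsFrobenioid S₂.F) (h3 : h.PreservesFrobeniusStructure) {A B : S₁.C} (s' s'' : A ⟶ B)
    (h' : S₁.IsPreStep s') (h'' : S₁.IsPreStep s'') (hb : PreFrobenioid.BaseEquivalent S₁.F s' s'')
    (hB₁ : ∀ b : S₁.tf.ratFnFunctor.obj (op A.base), IsUnit b)
    (hB₂ : ∀ b : S₂.tf.ratFnFunctor.obj (op (h.Ψ.functor.obj A).base), IsUnit b) :
    h.psiVal hF₁ hF₂ h3 A (ModelFrobenioid.frac hB₁ s' s'' : S₁.tf.ratFnFunctor.obj (op A.base)) =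
      (ModelFrobenioid.frac hB₂ (h.Ψ.functor.map s') (h.Ψ.functor.map s'') :
        S₂.tf.ratFnFunctor.obj (op (h.Ψ.functor.obj A).base)) := by
  obtain ⟨E, κ, κ', hκ, hκ', hsq⟩ := PreFrobenioid.exists_common_refinement hF₁ s' s''
    (S₁.isCoAngularPreStep_of_isPreStep h') (S₁.isCoAngularPreStep_of_isPreStep h'')
  have hbκ : PreFrobenioid.BaseEquivalent S₁.F κ κ' := by
    haveI : IsIso (PreFrobenioid.Base S₁.F s') := h'.2
    have e := congrArg (PreFrobenioid.Base S₁.F) hsq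
    rw [PreFrobenioid.base_comp, PreFrobenioid.base_comp,
      show PreFrobenioid.Base S₁.F s'' = PreFrobenioid.Base S₁.F s' from hb.symm] at e
    exact (cancel_mono _).1 e
  have hsq₂ : h.Ψ.functor.map κ ≫ h.Ψ.functor.map s' = h.Ψ.functor.map κ' ≫ h.Ψ.functor.map s'' := by
    rw [← Functor.map_comp, hsq, Functor.map_comp]
  have e₁ := ModelFrobenioid.ratIso_frac S₁.tf.ratFnFunctor_isGroupLike_holds hF₁.isPreFrobenioid.isDivisorial
    hF₁ hB₁ s' s'' h'.1 h''.1 κ κ' hκ hκ' hbκ hsq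
  have e₂ := ModelFrobenioid.ratIso_frac S₂.tf.ratFnFunctor_isGroupLike_holds hF₂.isPreFrobenioid.isDivisorial
    hF₂ hB₂ (h.Ψ.functor.map s') (h.Ψ.functor.map s'') (h.isPreStep_map h3 h').1 (h.isPreStep_map h3 h'').1
    (h.Ψ.functor.map κ) (h.Ψ.functor.map κ') (h.isCoAngularPreStep_map h3 hκ) (h.isCoAngularPreStep_map h3 hκ')
    (h.baseEquivalent_map hbκ) hsq₂
  show (ModelFrobenioid.ratIso S₂.tf.ratFnFunctor_isGroupLike_holds hF₂.isPreFrobenioid.isDivisorial hF₂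
      (h.Ψ.functor.obj A)).symm (h.biratUnitsEquiv hF₁ hF₂ h3 A
        (ModelFrobenioid.ratIso S₁.tf.ratFnFunctor_isGroupLike_holds hF₁.isPreFrobenioid.isDivisorial hF₁ A
          (ModelFrobenioid.frac hB₁ s' s'' : S₁.tf.ratFnFunctor.obj (op A.base)))) = _
  rw [MulEquiv.symm_apply_eq, e₁, e₂]
  rfl

/-! ### (a)/(c) restriction and `Aut`-actions: `ψ` commutes with transport along `Base(s)⁻¹` -/

/-- **(a)/(c)** `ψ` commutes with transport along the inverse of the base isomorphism of a pre-step `s : A → B`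
("`f ↦ f|_B`"; for an automorphism `σ`, the `Aut`-action): through [FrdI] Thm 5.2 (ii) both transports are the
push-forward along `s` resp. `Ψ(s)` (`ModelFrobenioid.ratIso_map_inv_baseMap`), and `Ψ^birat` commutes with
push-forward (`equivOfEquiv_push`). [cite: MochizukiEtTh2009, Thm 4.4 p.95] -/
theorem Thm44Hyp.psiVal_map_inv_baseMap (h : Thm44Hyp S₁ S₂) (hF₁ : PreFrobenioid.IsFrobenioid S₁.F)
    (hF₂ : PreFrobenioid.IsFrobenioid S₂.F) (h3 : h.PreservesFrobeniusStructure) {A B : S₁.C} (s : A ⟶ B)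
    (hs : S₁.IsPreStep s) [IsIso (ModelFrobenioid.baseMap s)] [IsIso (ModelFrobenioid.baseMap (h.Ψ.functor.map s))]
    (b : S₁.tf.ratFnFunctor.obj (op A.base)) :
    h.psiVal hF₁ hF₂ h3 B ((S₁.tf.ratFnFunctor.map (inv (ModelFrobenioid.baseMap s)).op).hom b) =
      (S₂.tf.ratFnFunctor.map (inv (ModelFrobenioid.baseMap (h.Ψ.functor.map s))).op).hom
        (h.psiVal hF₁ hF₂ h3 A b) := by
  have hsc : PreFrobenioid.IsCoAngularPreStep S₁.F s := S₁.isCoAngularPreStep_of_isPreStep hs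
  have ksc : PreFrobenioid.IsCoAngularPreStep S₂.F (h.Ψ.functor.map s) := h.isCoAngularPreStep_map h3 hsc
  have d₁ := ModelFrobenioid.ratIso_map_inv_baseMap S₁.tf.ratFnFunctor_isGroupLike_holds
    hF₁.isPreFrobenioid.isDivisorial hF₁ s hsc b
  have d₂ := PreFrobenioid.BiratUnits.equivOfEquiv_push h.Ψ (fun _ _ _ hf => h.isCoAngularPreStep_map h3 hf)
    (fun _ _ _ _ hb => h.baseEquivalent_map hb) hF₁ hF₂ (fun _ _ _ hf => h.isCoAngularPreStep_inverse_map h3 hf)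
    (fun _ _ _ _ hfg => h.baseEquivalent_inverse_map hfg) s hsc
    (ModelFrobenioid.ratIso S₁.tf.ratFnFunctor_isGroupLike_holds hF₁.isPreFrobenioid.isDivisorial hF₁ A b)
  have d₃ := ModelFrobenioid.ratIso_map_inv_baseMap S₂.tf.ratFnFunctor_isGroupLike_holds
    hF₂.isPreFrobenioid.isDivisorial hF₂ (h.Ψ.functor.map s) ksc (h.psiVal hF₁ hF₂ h3 A b)
  show (ModelFrobenioid.ratIso S₂.tf.ratFnFunctor_isGroupLike_holds hF₂.isPreFrobenioid.isDivisorial hF₂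
      (h.Ψ.functor.obj B)).symm (h.biratUnitsEquiv hF₁ hF₂ h3 B
        (ModelFrobenioid.ratIso S₁.tf.ratFnFunctor_isGroupLike_holds hF₁.isPreFrobenioid.isDivisorial hF₁ B
          ((S₁.tf.ratFnFunctor.map (inv (ModelFrobenioid.baseMap s)).op).hom b))) = _
  rw [MulEquiv.symm_apply_eq, d₁, d₃]
  show h.biratUnitsEquiv hF₁ hF₂ h3 B (PreFrobenioid.BiratUnits.push hF₁ s hsc _) =
    PreFrobenioid.BiratUnits.push hF₂ (h.Ψ.functor.map s) ksc
      (ModelFrobenioid.ratIso S₂.tf.ratFnFunctor_isGroupLike_holds hF₂.isPreFrobenioid.isDivisorial hF₂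
        (h.Ψ.functor.obj A) ((ModelFrobenioid.ratIso S₂.tf.ratFnFunctor_isGroupLike_holds
          hF₂.isPreFrobenioid.isDivisorial hF₂ (h.Ψ.functor.obj A)).symm _))
  rw [MulEquiv.apply_symm_apply]
  exact d₂

end AnySetting

/-! ### T44-L10 for the model instances `mkOfModel` -/

section Model

variable {tf₁ : TemperedFrobenioid T₁ D₁ VD₁} {hZ₁ : tf₁.monoidType = MonoidType.Z}
  {hP₁ : ∀ A : D₁ᵒᵖ, IsPerfect (tf₁.Φ.carrier A)} {hBΛ₁ : ∀ (Y : D₀ᵒᵖ) (b : T₁.BΛ.obj Y), IsUnit b}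
  {DS₁ : ∀ {A : D₁ᵒᵖ}, tf₁.Φ.carrier A → tf₁.Φ.carrier A → Prop} {IG₁ : D₁ → Prop}
  {gS₁ : ∀ A : D₁, IG₁ A → (X₁.Pi →* Aut A)} {gSs₁ : ∀ (A : D₁) (hA : IG₁ A), Function.Surjective (gS₁ A hA)}
  {NH₁ : Subgroup (Field.absoluteGaloisGroup K) → tf₁.category → ℕ+ → Prop}
  {AB₁ : ∀ {A B : tf₁.category}, Subgroup (Aut A) → (A ⟶ A) → (A ⟶ B) → Prop} {A₀₁ : tf₁.category}
  {hA₀₁ : PreFrobenioid.IsFrobeniusTrivial tf₁.toElem A₀₁} {hA₀₁' : IG₁ A₀₁.base}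
  {tf₂ : TemperedFrobenioid T₂ D₂ VD₂} {hZ₂ : tf₂.monoidType = MonoidType.Z}
  {hP₂ : ∀ A : D₂ᵒᵖ, IsPerfect (tf₂.Φ.carrier A)} {hBΛ₂ : ∀ (Y : D₀'ᵒᵖ) (b : T₂.BΛ.obj Y), IsUnit b}
  {DS₂ : ∀ {A : D₂ᵒᵖ}, tf₂.Φ.carrier A → tf₂.Φ.carrier A → Prop} {IG₂ : D₂ → Prop}
  {gS₂ : ∀ A : D₂, IG₂ A → (X₂.Pi →* Aut A)} {gSs₂ : ∀ (A : D₂) (hA : IG₂ A), Function.Surjective (gS₂ A hA)}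
  {NH₂ : Subgroup (Field.absoluteGaloisGroup K') → tf₂.category → ℕ+ → Prop}
  {AB₂ : ∀ {A B : tf₂.category}, Subgroup (Aut A) → (A ⟶ A) → (A ⟶ B) → Prop} {A₀₂ : tf₂.category}
  {hA₀₂ : PreFrobenioid.IsFrobeniusTrivial tf₂.toElem A₀₂} {hA₀₂' : IG₂ A₀₂.base}

/-- **T44-L10 `Thm44Hyp.BiratCompatible h ψ` DISCHARGED for the model instances `mkOfModel`** with
`ψ := psiModel` (the `Ψ^birat` of [FrdI] Cor 4.10 on `O^×(A^birat) = B(A_D)^×`): compatibility with (a)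
restriction along pre-steps, (b) the fractions `s'·(s'')⁻¹`, (c) the `Aut_C(A)`-actions; inputs "`C_i` is a
Frobenioid" ([FrdI] Thm 5.2 (ii)) and T44-L03. [cite: MochizukiEtTh2009, Thm 4.4 p.95] -/
theorem Thm44Hyp.biratCompatible_mkOfModel
    (h : Thm44Hyp (mkOfModel X₁ tf₁ hZ₁ hP₁ hBΛ₁ DS₁ IG₁ gS₁ gSs₁ NH₁ AB₁ A₀₁ hA₀₁ hA₀₁')
      (mkOfModel X₂ tf₂ hZ₂ hP₂ hBΛ₂ DS₂ IG₂ gS₂ gSs₂ NH₂ AB₂ A₀₂ hA₀₂ hA₀₂'))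
    (hF₁ : PreFrobenioid.IsFrobenioid tf₁.toElem) (hF₂ : PreFrobenioid.IsFrobenioid tf₂.toElem)
    (h3 : h.PreservesFrobeniusStructure) :
    h.BiratCompatible (h.psiModel hF₁ hF₂ h3) where
  restrict s hs ks f := by
    haveI : IsIso (ModelFrobenioid.baseMap s) := hs.2
    haveI : IsIso (ModelFrobenioid.baseMap (h.Ψ.functor.map s)) := ks.2
    apply Units.ext
    exact h.psiVal_map_inv_baseMap hF₁ hF₂ h3 s hs (Units.val f)
  frac s' s'' h' h'' hb k' k'' kb := by
    apply Units.ext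
    exact (h.psiVal_frac hF₁ hF₂ h3 s' s'' h' h'' hb _ _).symm
  aut σ f := by
    have hs : PreFrobenioid.IsPreStep tf₁.toElem σ.hom := PreFrobenioid.isPreStep_of_isIso tf₁.toElem σ.hom
    haveI : IsIso (ModelFrobenioid.baseMap σ.hom) := hs.2
    haveI : IsIso (ModelFrobenioid.baseMap (h.Ψ.functor.map σ.hom)) := (h.isPreStep_map h3 hs).2
    have i₁ : ModelFrobenioid.baseMap σ.inv = inv (ModelFrobenioid.baseMap σ.hom) :=
      (IsIso.inv_eq_of_hom_inv_id (ModelFrobenioid.baseMap_hom_inv _ σ)).symm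
    have i₂ : ModelFrobenioid.baseMap (h.Ψ.functor.map σ.inv) =
        inv (ModelFrobenioid.baseMap (h.Ψ.functor.map σ.hom)) :=
      (IsIso.inv_eq_of_hom_inv_id (by
        rw [← ModelFrobenioid.baseMap_comp, ← h.Ψ.functor.map_comp, σ.hom_inv_id, h.Ψ.functor.map_id,
          ModelFrobenioid.baseMap_id])).symm
    apply Units.ext
    have key := h.psiVal_map_inv_baseMap hF₁ hF₂ h3 σ.hom hs (Units.val f)
    rw [← i₁, ← i₂] at key
    exact key

end Model

/-! ### At the canonical vocabularies / for `mkOfModelCanonical`: Thm 4.4 (ii) ⇐ {Rmk 3.7.2, `hBmon`} -/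

section Canonical

variable {T₁' : RealifiedDivisorMonoids (D₀ := D₀) treeMonoidVocab.{w}}
  {T₂' : RealifiedDivisorMonoids (D₀ := D₀') treeMonoidVocab.{w}}
  {IsRational₁ IsStrictlyRational₁ : (D₁ᵒᵖ ⥤ CommMonCat.{w}) → Prop}
  {IsRational₂ IsStrictlyRational₂ : (D₂ᵒᵖ ⥤ CommMonCat.{w}) → Prop}
  {tf₁ : TemperedFrobenioid T₁' D₁ (treeCatVocab D₁ IsRational₁ IsStrictlyRational₁)}
  {hZ₁ : tf₁.monoidType = MonoidType.Z} {hP₁ : ∀ A : D₁ᵒᵖ, IsPerfect (tf₁.Φ.carrier A)}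
  {IG₁ : D₁ → Prop} {gS₁ : ∀ A : D₁, IG₁ A → (X₁.Pi →* Aut A)}
  {gSs₁ : ∀ (A : D₁) (hA : IG₁ A), Function.Surjective (gS₁ A hA)}
  {NH₁ : Subgroup (Field.absoluteGaloisGroup K) → tf₁.category → ℕ+ → Prop} {A₀₁ : tf₁.category}
  {hA₀₁ : PreFrobenioid.IsFrobeniusTrivial tf₁.toElem A₀₁} {hA₀₁' : IG₁ A₀₁.base}
  {tf₂ : TemperedFrobenioid T₂' D₂ (treeCatVocab D₂ IsRational₂ IsStrictlyRational₂)}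
  {hZ₂ : tf₂.monoidType = MonoidType.Z} {hP₂ : ∀ A : D₂ᵒᵖ, IsPerfect (tf₂.Φ.carrier A)}
  {IG₂ : D₂ → Prop} {gS₂ : ∀ A : D₂, IG₂ A → (X₂.Pi →* Aut A)}
  {gSs₂ : ∀ (A : D₂) (hA : IG₂ A), Function.Surjective (gS₂ A hA)}
  {NH₂ : Subgroup (Field.absoluteGaloisGroup K') → tf₂.category → ℕ+ → Prop} {A₀₂ : tf₂.category}
  {hA₀₂ : PreFrobenioid.IsFrobeniusTrivial tf₂.toElem A₀₂} {hA₀₂' : IG₂ A₀₂.base}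

/-- **[EtTh] Thm 4.4 (ii), fraction-pair clause `Thm44_ii h ψ`, for the canonical model instances with the
CONSTRUCTED `ψ = Ψ^birat` (`psiModel`) ⇐ {Rmk 3.7.2 (`Remark372 D₀ / D₀'`), `hBmon₁ / hBmon₂`} ONLY** — rows
T44-L03 ([FrdI] Thm 3.4), T44-L10 ([FrdI] Cor 4.10), T44-L12 ([FrdI] Thm 4.2 (ii), print's form) all discharged.
[cite: MochizukiEtTh2009, Thm 4.4 p.94] -/
theorem thm44_ii_mkOfModelCanonical
    (h : Thm44Hyp (mkOfModelCanonical X₁ tf₁ hZ₁ hP₁ IG₁ gS₁ gSs₁ NH₁ A₀₁ hA₀₁ hA₀₁')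
      (mkOfModelCanonical X₂ tf₂ hZ₂ hP₂ IG₂ gS₂ gSs₂ NH₂ A₀₂ hA₀₂ hA₀₂'))
    (h372 : TemperedFrobenioid.Remark372 D₀) (h372' : TemperedFrobenioid.Remark372 D₀')
    (hBmon₁ : IsMonoidOn tf₁.ratFnFunctor) (hBmon₂ : IsMonoidOn tf₂.ratFnFunctor) :
    Thm44_ii h (h.psiModel (tf₁.isFrobenioid_treeCatVocab_of_isMonoidOn hBmon₁)
      (tf₂.isFrobenioid_treeCatVocab_of_isMonoidOn hBmon₂)
      (h.preservesFrobeniusStructure_treeVocab h372 h372' hBmon₁ hBmon₂)) :=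
  thm44_ii_mkOfModelCanonical_of_frac tf₁ hZ₁ hP₁ IG₁ gS₁ gSs₁ NH₁ A₀₁ hA₀₁ hA₀₁' tf₂ hZ₂ hP₂ IG₂ gS₂ gSs₂ NH₂
    A₀₂ hA₀₂ hA₀₂' h _ h372 h372' hBmon₁ hBmon₂ fun s' s'' h' h'' hb k' k'' kb =>
    (h.biratCompatible_mkOfModel (tf₁.isFrobenioid_treeCatVocab_of_isMonoidOn hBmon₁)
      (tf₂.isFrobenioid_treeCatVocab_of_isMonoidOn hBmon₂)
      (h.preservesFrobeniusStructure_treeVocab h372 h372' hBmon₁ hBmon₂)).frac s' s'' h' h'' hb k' k'' kb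

end Canonical

end BiKummerSetting

end Literature.AnabelianGeometry.EtaleTheta

end
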